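import Mathlib
import HarnessLib

/-!
# Occupation (amplitude-budget) identity for the positive viscous Katz–Pavlović chain
# (helper file under the crux `SubOnsagerCeiling.ForwardTailCeilingKP`, stmt-NavierStokesRegularity-27057, `--supports`)

Def-free identities and inequalities about the TIME-INTEGRATED SQUARES ("occupations")
`O_k(T) = ∫₀ᵀ Z_k(t)² dt` of an honest solution `Z_k : [0,s] → ℝ` (`k ≥ -1`, `Z_{-1} ≡ 0`) of the NS-scaled
viscous chain `Ż_k = c₀ (b^{5(k-1)/2} Z_{k-1}² − b^{5k/2} Z_k Z_{k+1}) − ν b^{2k} Z_k` from the one-shell datum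
`Z_k(0) = x₀ 1_{k=0}` — the hypotheses are VERBATIM those of `Theorems.KPChainPeak` / the LEAD's chain rungs.
Integrating the equation of the shell `k+1` over `[0,T]` (it starts empty) gives the

* **occupation identity** `occupation_identity`:
  `c₀ b^{5k/2} ∫₀ᵀ Z_k² = Z_{k+1}(T) + c₀ b^{5(k+1)/2} ∫₀ᵀ Z_{k+1} Z_{k+2} + ν b^{2(k+1)} ∫₀ᵀ Z_{k+1}` (every `k ≥ 0`,
  `T ∈ [0,s]`, any signs, any `ν`);
* `next_le_occupation` — for the non-negative chain (`c₀, ν ≥ 0`): `Z_{k+1}(T) ≤ c₀ b^{5k/2} ∫₀ᵀ Z_k²` — to raise the next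
  shell to a level, the present shell must have been OCCUPIED for that long (ν-uniform);
* `occupation_le_of_sup` — conversely, caps `Z_{k+1} ≤ A`, `Z_{k+2} ≤ B` on `[0,s]` give
  `c₀ b^{5k/2} ∫₀ᵀ Z_k² ≤ A + (c₀ b^{5(k+1)/2} A B + ν b^{2(k+1)} A)·T`.

Use / census (memo OCCUPATION-LEAK-leafhand4-g12.md on the item).  With `O_k = ∫Z_k²` and Cauchy–Schwarz the identity reads
`O_k ≤ Z_{k+1}(T)/(c₀Λ_k) + b^{5/2} √(O_{k+1} O_{k+2}) + (viscous)`, `Λ_k = b^{5k/2}`; the weighted supremum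
`sup_k b^{σk} O_k` contracts under this one-step budget with factor `b^{5/2 − 3σ/2}`, i.e. exactly for `σ > 5/3`, while
the viscous term is `ν`-uniform only for `σ ≤ 5/6 + θ` (`θ` the shell-barrier exponent): the amplitude budget is
KOLMOGOROV-CRITICAL (`σ = 5/3`, `θ = 5/6`), which is why the time-integrated ("occupation") bound asked by the
refutation lineage of the asides stmt-25507 / stmt-26608 (`…SideBranchOccupationHorizon.lean`) cannot come from flux or
amplitude budgets alone.  Nothing here closes a stub.
HONEST FRAMING: statements about MODEL lattice ODEs (route SubOnsagerCeiling, rung TL-M2Break); nothing here bears on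
Navier–Stokes regularity and no crux or summit is proved.
[cite: Tao2016AveragedNS, §4 (4.13)] [cite: BarbatoMorandinRomito2011, §2 (the chain)]
-/

noncomputable section

-- the sub-problem namespace `NavierStokesRegularity.NavierStokesRegularity` is the tree's layout (D-0017)
set_option linter.dupNamespace false

namespace Summit.NavierStokesRegularity.NavierStokesRegularity.Theorems.KPChainOccupation

open Set MeasureTheory intervalIntegral

/-- The equation of the shell `k+1` (`k : ℕ`) with the natural-number casts normalised:
`Ż_{k+1} = c₀ (b^{5k/2} Z_k² − b^{5(k+1)/2} Z_{k+1} Z_{k+2}) − ν b^{2(k+1)} Z_{k+1}` within `[0,s]`.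
[cite: Tao2016AveragedNS, §4 (4.13)] -/
theorem hasDerivWithinAt_succ {b c₀ ν s : ℝ} {Z : ℤ → ℝ → ℝ}
    (hode : ∀ k : ℕ, ∀ t ∈ Icc 0 s, HasDerivWithinAt (Z k)
      (c₀ * (b ^ ((5 : ℝ) * ((k : ℝ) - 1) / 2) * Z ((k : ℤ) - 1) t ^ 2 -
          b ^ ((5 : ℝ) * (k : ℝ) / 2) * (Z k t * Z ((k : ℤ) + 1) t)) -
        ν * b ^ ((2 : ℝ) * (k : ℝ)) * Z k t) (Icc 0 s) t) (k : ℕ) :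
    ∀ t ∈ Icc 0 s, HasDerivWithinAt (Z ((k : ℤ) + 1))
      (c₀ * (b ^ ((5 : ℝ) * (k : ℝ) / 2) * Z (k : ℤ) t ^ 2 -
          b ^ ((5 : ℝ) * ((k : ℝ) + 1) / 2) * (Z ((k : ℤ) + 1) t * Z ((k : ℤ) + 2) t)) -
        ν * b ^ ((2 : ℝ) * ((k : ℝ) + 1)) * Z ((k : ℤ) + 1) t) (Icc 0 s) t := by
  intro t ht
  have hidx : (((k + 1 : ℕ) : ℤ)) = (k : ℤ) + 1 := by push_cast; ring
  have h := hode (k + 1) t ht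
  rw [hidx] at h
  have e1 : (5 : ℝ) * ((((k + 1 : ℕ)) : ℝ) - 1) / 2 = (5 : ℝ) * (k : ℝ) / 2 := by push_cast; ring
  have e2 : (5 : ℝ) * (((k + 1 : ℕ) : ℝ)) / 2 = (5 : ℝ) * ((k : ℝ) + 1) / 2 := by push_cast; ring
  have e3 : (2 : ℝ) * (((k + 1 : ℕ) : ℝ)) = (2 : ℝ) * ((k : ℝ) + 1) := by push_cast; ring
  have e4 : (k : ℤ) + 1 - 1 = (k : ℤ) := by ring
  have e5 : (k : ℤ) + 1 + 1 = (k : ℤ) + 2 := by ring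
  rw [e1, e2, e3, e4, e5] at h
  exact h

/-- Continuity of the shells `k`, `k+1`, `k+2` on `[0,T] ⊆ [0,s]` with integer casts normalised. [this file] -/
theorem continuousOn_shells {s T : ℝ} {Z : ℤ → ℝ → ℝ}
    (hcont : ∀ k : ℕ, ContinuousOn (Z k) (Icc 0 s)) (hTs : T ≤ s) (k : ℕ) :
    ContinuousOn (Z (k : ℤ)) (Icc 0 T) ∧ ContinuousOn (Z ((k : ℤ) + 1)) (Icc 0 T) ∧
      ContinuousOn (Z ((k : ℤ) + 2)) (Icc 0 T) := by
  have hsub : Icc (0 : ℝ) T ⊆ Icc 0 s := Icc_subset_Icc le_rfl hTs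
  have h1 : (((k + 1 : ℕ) : ℤ)) = (k : ℤ) + 1 := by push_cast; ring
  have h2 : (((k + 2 : ℕ) : ℤ)) = (k : ℤ) + 2 := by push_cast; ring
  refine ⟨(hcont k).mono hsub, ?_, ?_⟩
  · have := (hcont (k + 1)).mono hsub; rwa [h1] at this
  · have := (hcont (k + 2)).mono hsub; rwa [h2] at this

/-- **Occupation identity.** Along an honest solution of the viscous chain from the one-shell datum (any signs, any
`ν`, `c₀`, `b`), for every shell `k ≥ 0` and every `T ∈ [0,s]`:
`c₀ b^{5k/2} ∫₀ᵀ Z_k² = Z_{k+1}(T) + c₀ b^{5(k+1)/2} ∫₀ᵀ Z_{k+1} Z_{k+2} + ν b^{2(k+1)} ∫₀ᵀ Z_{k+1}`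
(the equation of the shell `k+1`, which starts empty, integrated over `[0,T]`). [this file] -/
theorem occupation_identity {b c₀ ν s x₀ : ℝ} {Z : ℤ → ℝ → ℝ}
    (hdat : ∀ k : ℤ, Z k 0 = if k = 0 then x₀ else 0)
    (hcont : ∀ k : ℕ, ContinuousOn (Z k) (Icc 0 s))
    (hode : ∀ k : ℕ, ∀ t ∈ Icc 0 s, HasDerivWithinAt (Z k)
      (c₀ * (b ^ ((5 : ℝ) * ((k : ℝ) - 1) / 2) * Z ((k : ℤ) - 1) t ^ 2 -
          b ^ ((5 : ℝ) * (k : ℝ) / 2) * (Z k t * Z ((k : ℤ) + 1) t)) -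
        ν * b ^ ((2 : ℝ) * (k : ℝ)) * Z k t) (Icc 0 s) t)
    (k : ℕ) {T : ℝ} (hT : T ∈ Icc 0 s) :
    c₀ * b ^ ((5 : ℝ) * (k : ℝ) / 2) * (∫ t in (0 : ℝ)..T, Z (k : ℤ) t ^ 2) =
      Z ((k : ℤ) + 1) T +
        c₀ * b ^ ((5 : ℝ) * ((k : ℝ) + 1) / 2) * (∫ t in (0 : ℝ)..T, Z ((k : ℤ) + 1) t * Z ((k : ℤ) + 2) t) +
        ν * b ^ ((2 : ℝ) * ((k : ℝ) + 1)) * (∫ t in (0 : ℝ)..T, Z ((k : ℤ) + 1) t) := by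
  obtain ⟨hc0, hc1, hc2⟩ := continuousOn_shells hcont hT.2 k
  set B₀ : ℝ := b ^ ((5 : ℝ) * (k : ℝ) / 2) with hB₀
  set B₁ : ℝ := b ^ ((5 : ℝ) * ((k : ℝ) + 1) / 2) with hB₁
  set B₂ : ℝ := b ^ ((2 : ℝ) * ((k : ℝ) + 1)) with hB₂
  -- the three integrands are continuous on `[0,T]`, hence interval integrable
  have hF1c : ContinuousOn (fun t => c₀ * B₀ * Z (k : ℤ) t ^ 2) (Icc 0 T) :=
    continuousOn_const.mul (hc0.pow 2)
  have hF2c : ContinuousOn (fun t => c₀ * B₁ * (Z ((k : ℤ) + 1) t * Z ((k : ℤ) + 2) t)) (Icc 0 T) :=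
    continuousOn_const.mul (hc1.mul hc2)
  have hF3c : ContinuousOn (fun t => ν * B₂ * Z ((k : ℤ) + 1) t) (Icc 0 T) :=
    continuousOn_const.mul hc1
  have hF1i : IntervalIntegrable (fun t => c₀ * B₀ * Z (k : ℤ) t ^ 2) volume 0 T :=
    hF1c.intervalIntegrable_of_Icc hT.1
  have hF2i : IntervalIntegrable (fun t => c₀ * B₁ * (Z ((k : ℤ) + 1) t * Z ((k : ℤ) + 2) t)) volume 0 T :=
    hF2c.intervalIntegrable_of_Icc hT.1
  have hF3i : IntervalIntegrable (fun t => ν * B₂ * Z ((k : ℤ) + 1) t) volume 0 T :=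
    hF3c.intervalIntegrable_of_Icc hT.1
  -- fundamental theorem of calculus for the shell `k+1` on `[0,T]`
  have hderiv : ∀ t ∈ Ioo 0 T, HasDerivWithinAt (Z ((k : ℤ) + 1))
      (c₀ * B₀ * Z (k : ℤ) t ^ 2 - c₀ * B₁ * (Z ((k : ℤ) + 1) t * Z ((k : ℤ) + 2) t) -
        ν * B₂ * Z ((k : ℤ) + 1) t) (Ioi t) t := by
    intro t ht
    have hts : t ∈ Icc 0 s := ⟨ht.1.le, ht.2.le.trans hT.2⟩
    have h := hasDerivWithinAt_succ hode k t hts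
    have hnhds : Icc (0 : ℝ) s ∈ nhds t := Icc_mem_nhds ht.1 (lt_of_lt_of_le ht.2 hT.2)
    have h' := (h.hasDerivAt hnhds).hasDerivWithinAt (s := Ioi t)
    refine h'.congr_deriv ?_
    rw [hB₀, hB₁, hB₂]; ring
  have hint : IntervalIntegrable (fun t => c₀ * B₀ * Z (k : ℤ) t ^ 2 -
      c₀ * B₁ * (Z ((k : ℤ) + 1) t * Z ((k : ℤ) + 2) t) - ν * B₂ * Z ((k : ℤ) + 1) t) volume 0 T :=
    (hF1i.sub hF2i).sub hF3i
  have hFTC := integral_eq_sub_of_hasDeriv_right_of_le hT.1 hc1 hderiv hint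
  have hz0 : Z ((k : ℤ) + 1) 0 = 0 := by
    rw [hdat]
    have hne : (k : ℤ) + 1 ≠ 0 := by omega
    rw [if_neg hne]
  rw [hz0, sub_zero, intervalIntegral.integral_sub (hF1i.sub hF2i) hF3i,
    intervalIntegral.integral_sub hF1i hF2i, intervalIntegral.integral_const_mul,
    intervalIntegral.integral_const_mul, intervalIntegral.integral_const_mul] at hFTC
  linarith

/-- **The next shell is bounded by the occupation of the present one** (non-negative chain, `c₀ ≥ 0`, `ν ≥ 0`,
`b > 0`): `Z_{k+1}(T) ≤ c₀ b^{5k/2} ∫₀ᵀ Z_k(t)² dt` for every `k ≥ 0`, `T ∈ [0,s]` — uniformly in `ν`. [this file] -/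
theorem next_le_occupation {b c₀ ν s x₀ : ℝ} (hb : 0 < b) (hc₀ : 0 ≤ c₀) (hν : 0 ≤ ν) {Z : ℤ → ℝ → ℝ}
    (hdat : ∀ k : ℤ, Z k 0 = if k = 0 then x₀ else 0)
    (hcont : ∀ k : ℕ, ContinuousOn (Z k) (Icc 0 s))
    (hode : ∀ k : ℕ, ∀ t ∈ Icc 0 s, HasDerivWithinAt (Z k)
      (c₀ * (b ^ ((5 : ℝ) * ((k : ℝ) - 1) / 2) * Z ((k : ℤ) - 1) t ^ 2 -
          b ^ ((5 : ℝ) * (k : ℝ) / 2) * (Z k t * Z ((k : ℤ) + 1) t)) -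
        ν * b ^ ((2 : ℝ) * (k : ℝ)) * Z k t) (Icc 0 s) t)
    (hnn : ∀ t ∈ Icc 0 s, ∀ k : ℕ, 1 ≤ k → 0 ≤ Z k t)
    (k : ℕ) {T : ℝ} (hT : T ∈ Icc 0 s) :
    Z ((k : ℤ) + 1) T ≤ c₀ * b ^ ((5 : ℝ) * (k : ℝ) / 2) * (∫ t in (0 : ℝ)..T, Z (k : ℤ) t ^ 2) := by
  have hid := occupation_identity hdat hcont hode k hT
  have h1 : (((k + 1 : ℕ) : ℤ)) = (k : ℤ) + 1 := by push_cast; ring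
  have h2 : (((k + 2 : ℕ) : ℤ)) = (k : ℤ) + 2 := by push_cast; ring
  have hz1 : ∀ t ∈ Icc 0 s, 0 ≤ Z ((k : ℤ) + 1) t := fun t ht => by
    have := hnn t ht (k + 1) (by omega); rwa [h1] at this
  have hz2 : ∀ t ∈ Icc 0 s, 0 ≤ Z ((k : ℤ) + 2) t := fun t ht => by
    have := hnn t ht (k + 2) (by omega); rwa [h2] at this
  have hsub : ∀ t ∈ Icc (0 : ℝ) T, t ∈ Icc 0 s := fun t ht => ⟨ht.1, ht.2.trans hT.2⟩
  have hI2 : 0 ≤ (∫ t in (0 : ℝ)..T, Z ((k : ℤ) + 1) t * Z ((k : ℤ) + 2) t) :=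
    intervalIntegral.integral_nonneg hT.1 fun t ht => mul_nonneg (hz1 t (hsub t ht)) (hz2 t (hsub t ht))
  have hI3 : 0 ≤ (∫ t in (0 : ℝ)..T, Z ((k : ℤ) + 1) t) :=
    intervalIntegral.integral_nonneg hT.1 fun t ht => hz1 t (hsub t ht)
  have hB₁ : 0 ≤ c₀ * b ^ ((5 : ℝ) * ((k : ℝ) + 1) / 2) := mul_nonneg hc₀ (Real.rpow_pos_of_pos hb _).le
  have hB₂ : 0 ≤ ν * b ^ ((2 : ℝ) * ((k : ℝ) + 1)) := mul_nonneg hν (Real.rpow_pos_of_pos hb _).le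
  nlinarith [mul_nonneg hB₁ hI2, mul_nonneg hB₂ hI3]

/-- **Occupation from caps above** (non-negative chain, `c₀ ≥ 0`, `ν ≥ 0`, `b > 0`): if `Z_{k+1} ≤ A` and `Z_{k+2} ≤ B`
on `[0,s]`, then `c₀ b^{5k/2} ∫₀ᵀ Z_k² ≤ A + (c₀ b^{5(k+1)/2} A B + ν b^{2(k+1)} A)·T` for `T ∈ [0,s]` — the present
shell cannot be occupied longer than the (capped) drains above can account for. [this file] -/
theorem occupation_le_of_sup {b c₀ ν s x₀ A B : ℝ} (hb : 0 < b) (hc₀ : 0 ≤ c₀) (hν : 0 ≤ ν) {Z : ℤ → ℝ → ℝ}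
    (hdat : ∀ k : ℤ, Z k 0 = if k = 0 then x₀ else 0)
    (hcont : ∀ k : ℕ, ContinuousOn (Z k) (Icc 0 s))
    (hode : ∀ k : ℕ, ∀ t ∈ Icc 0 s, HasDerivWithinAt (Z k)
      (c₀ * (b ^ ((5 : ℝ) * ((k : ℝ) - 1) / 2) * Z ((k : ℤ) - 1) t ^ 2 -
          b ^ ((5 : ℝ) * (k : ℝ) / 2) * (Z k t * Z ((k : ℤ) + 1) t)) -
        ν * b ^ ((2 : ℝ) * (k : ℝ)) * Z k t) (Icc 0 s) t)
    (hnn : ∀ t ∈ Icc 0 s, ∀ k : ℕ, 1 ≤ k → 0 ≤ Z k t)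
    (k : ℕ) (hA : ∀ t ∈ Icc 0 s, Z ((k : ℤ) + 1) t ≤ A) (hB : ∀ t ∈ Icc 0 s, Z ((k : ℤ) + 2) t ≤ B)
    {T : ℝ} (hT : T ∈ Icc 0 s) :
    c₀ * b ^ ((5 : ℝ) * (k : ℝ) / 2) * (∫ t in (0 : ℝ)..T, Z (k : ℤ) t ^ 2) ≤
      A + (c₀ * b ^ ((5 : ℝ) * ((k : ℝ) + 1) / 2) * (A * B) + ν * b ^ ((2 : ℝ) * ((k : ℝ) + 1)) * A) * T := by
  have hid := occupation_identity hdat hcont hode k hT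
  obtain ⟨_, hc1, hc2⟩ := continuousOn_shells hcont hT.2 k
  have h1 : (((k + 1 : ℕ) : ℤ)) = (k : ℤ) + 1 := by push_cast; ring
  have h2 : (((k + 2 : ℕ) : ℤ)) = (k : ℤ) + 2 := by push_cast; ring
  have hz1 : ∀ t ∈ Icc 0 s, 0 ≤ Z ((k : ℤ) + 1) t := fun t ht => by
    have := hnn t ht (k + 1) (by omega); rwa [h1] at this
  have hz2 : ∀ t ∈ Icc 0 s, 0 ≤ Z ((k : ℤ) + 2) t := fun t ht => by
    have := hnn t ht (k + 2) (by omega); rwa [h2] at this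
  have hsub : ∀ t ∈ Icc (0 : ℝ) T, t ∈ Icc 0 s := fun t ht => ⟨ht.1, ht.2.trans hT.2⟩
  -- pointwise caps of the two drain integrands
  have hI2 : (∫ t in (0 : ℝ)..T, Z ((k : ℤ) + 1) t * Z ((k : ℤ) + 2) t) ≤ ∫ t in (0 : ℝ)..T, A * B := by
    refine intervalIntegral.integral_mono_on hT.1 ((hc1.mul hc2).intervalIntegrable_of_Icc hT.1)
      intervalIntegrable_const fun t ht => ?_
    exact mul_le_mul (hA t (hsub t ht)) (hB t (hsub t ht)) (hz2 t (hsub t ht))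
      ((hz1 t (hsub t ht)).trans (hA t (hsub t ht)))
  have hI3 : (∫ t in (0 : ℝ)..T, Z ((k : ℤ) + 1) t) ≤ ∫ t in (0 : ℝ)..T, A :=
    intervalIntegral.integral_mono_on hT.1 (hc1.intervalIntegrable_of_Icc hT.1) intervalIntegrable_const
      fun t ht => hA t (hsub t ht)
  rw [intervalIntegral.integral_const, smul_eq_mul, sub_zero] at hI2 hI3
  have hT0 : Z ((k : ℤ) + 1) T ≤ A := hA T hT
  have hB₁ : 0 ≤ c₀ * b ^ ((5 : ℝ) * ((k : ℝ) + 1) / 2) := mul_nonneg hc₀ (Real.rpow_pos_of_pos hb _).le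
  have hB₂ : 0 ≤ ν * b ^ ((2 : ℝ) * ((k : ℝ) + 1)) := mul_nonneg hν (Real.rpow_pos_of_pos hb _).le
  have e1 := mul_le_mul_of_nonneg_left hI2 hB₁
  have e2 := mul_le_mul_of_nonneg_left hI3 hB₂
  nlinarith [e1, e2]

end Summit.NavierStokesRegularity.NavierStokesRegularity.Theorems.KPChainOccupation
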